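import Summits.BirchSwinnertonDyer.BirchSwinnertonDyer.Theorems.DefiniteThetaDerivedHeightCapTowerSqrt
import Summits.BirchSwinnertonDyer.BirchSwinnertonDyer.Theorems.DefiniteThetaDerivedHeightCapTowerSqrtDefiniteSubfield
import Mathlib.RingTheory.ClassGroup.Basic
import Mathlib.RingTheory.PrincipalIdealDomain
import HarnessLib

/-!
# The degenerate tower over `K ≅ ℚ` (`Pic(ℤ + cℤ) = 1`), and the square root along the tower for EVERY number field `K` at odd `p`

Route-independent `Theorems` file (cell `b2b-bsdres`, seat `b2b-bsdres-x10b`, gen 44), part 10 of the series «tower square root» serving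
crux `DerivedHeightCap` (stmt-BirchSwinnertonDyer-18438, route DefiniteTheta), registered stub `stub_towerSqrt`.
HONEST FRAMING: no curve asserted, no class closed, BSD not proved by any of this.

* §1 `[K:ℚ] = 1`: every element of `K` is rational, every element of `𝒪_c = ℤ + c𝓞_K` is an integer, so `𝒪_c` is a principal ideal ring
  (image of `ℤ`) and `Pic(𝒪_c)` is trivial (`subsingleton_classGroup_quadOrder`); the layer groups `Pic(𝒪_{p^{n+1}})/Δ` are trivial.
* §2 `mem_augIdeal_pow_of_subsingleton`: over a trivial group, `θ · ι θ ∈ I^{2ρ} ⇒ θ ∈ I^ρ` (`ε` is injective on `ℤ_p[1]`, `I = 0`).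
* §3 `towerSqrt_of_finrank_eq_one` (the degenerate branch) and **`towerSqrt_of_ne_two`**: the registered stub for EVERY number field
  `K` and every ODD prime `p` — by part 9 a tower forces `[K:ℚ] = 1` (this file) or `K` imaginary quadratic (part 8). What separates this
  from the registered signature is exactly `p = 2` (the 2-adic layer structure of `Pic(𝒪_{2^n})`, one level higher; not in the tree).

## References
* [BertoliniDarmon2005] §1.2; [Cox2013] §7.A (orders `ℤ + c𝓞_K`).
-/

noncomputable section

-- D-0017: single-problem summit, the namespace repeats the problem name by design.
set_option linter.dupNamespace false

namespace Summit.BirchSwinnertonDyer.BirchSwinnertonDyer.Theorems.TowerSqrt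

open Literature.NumberTheory.Automorphic Literature.NumberTheory.EllipticCurves NumberField Module
open Literature.NumberTheory.EllipticCurves (augIdeal augmentation augmentation_single mem_augIdeal_iff)

universe u

variable {K : Type u} [Field K] [NumberField K]

/-! ### §1 `[K:ℚ] = 1`: the orders `ℤ + c𝓞_K` are `ℤ`, their Picard groups are trivial -/

/-- If `[K:ℚ] = 1`, every element of `K` is rational. [folklore] -/
theorem exists_eq_algebraMap_of_finrank_eq_one (h1 : finrank ℚ K = 1) (x : K) : ∃ r : ℚ, x = algebraMap ℚ K r := by
  obtain ⟨r, hr⟩ := (finrank_eq_one_iff_of_nonzero' (1 : K) one_ne_zero).mp h1 x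
  exact ⟨r, by rw [← hr, Algebra.smul_def, mul_one]⟩

/-- If `[K:ℚ] = 1`, every element of `𝒪_c = ℤ + c𝓞_K` is an integer (`𝓞_K = ℤ`: integers of `ℚ` are integrally closed). [folklore] -/
theorem exists_eq_intCast_of_mem_quadOrder (h1 : finrank ℚ K = 1) {c : ℕ} {x : K} (hx : x ∈ quadOrder K c) :
    ∃ m : ℤ, x = (m : K) := by
  obtain ⟨a, y, rfl⟩ := mem_quadOrder_iff.mp hx
  obtain ⟨r, hr⟩ := exists_eq_algebraMap_of_finrank_eq_one h1 (algebraMap (𝓞 K) K y)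
  -- r is integral over ℤ, hence an integer
  have hint : IsIntegral ℤ r := by
    have hy : IsIntegral ℤ (algebraMap (𝓞 K) K y) := y.isIntegral_coe
    rw [hr] at hy
    exact (isIntegral_algebraMap_iff (algebraMap ℚ K).injective).mp hy
  obtain ⟨m, hm⟩ := IsIntegrallyClosed.isIntegral_iff.mp hint
  refine ⟨a + c * m, ?_⟩
  rw [hr, ← hm]
  push_cast
  simp [eq_intCast]

/-- If `[K:ℚ] = 1`, `ℤ → 𝒪_c` is onto. [folklore] -/
theorem algebraMap_int_quadOrder_surjective (h1 : finrank ℚ K = 1) (c : ℕ) :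
    Function.Surjective (algebraMap ℤ (quadOrder K c)) := by
  intro z
  obtain ⟨m, hm⟩ := exists_eq_intCast_of_mem_quadOrder h1 z.2
  refine ⟨m, Subtype.ext ?_⟩
  rw [hm]
  simp

/-- **`Pic(ℤ + c𝓞_K)` is trivial when `[K:ℚ] = 1`** (`𝒪_c` is a quotient — in fact a copy — of `ℤ`, a principal ideal ring).
[cite: Cox2013, §7.A] -/
theorem subsingleton_classGroup_quadOrder (h1 : finrank ℚ K = 1) (c : ℕ) [NeZero c] :
    Subsingleton (ClassGroup (quadOrder K c)) := by
  haveI : IsPrincipalIdealRing (quadOrder K c) :=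
    IsPrincipalIdealRing.of_surjective (algebraMap ℤ (quadOrder K c)) (algebraMap_int_quadOrder_surjective h1 c)
  exact Fintype.card_le_one_iff_subsingleton.mp (card_classGroup_eq_one (R := quadOrder K c)).le

/-! ### §2 The square root over a trivial group -/

/-- Over a trivial group every element of `ℤ_p[G]` is `(ε θ) · 1`. [folklore] -/
theorem eq_single_augmentation_of_subsingleton {p : ℕ} [Fact p.Prime] {G : Type*} [CommGroup G] [Subsingleton G]
    (θ : MonoidAlgebra ℤ_[p] G) : θ = MonoidAlgebra.single 1 (augmentation ℤ_[p] G θ) := by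
  induction θ using MonoidAlgebra.induction_linear with
  | zero => simp
  | add x y hx hy => rw [map_add, MonoidAlgebra.single_add, ← hx, ← hy]
  | single σ c => rw [augmentation_single, Subsingleton.elim σ 1]

/-- **`θ · ι θ ∈ I^{2ρ} ⇒ θ ∈ I^ρ` over a trivial group**: `ε(θ)² = ε(θ · ιθ) = 0`, so `θ = ε(θ)·1 = 0`. [folklore] -/
theorem mem_augIdeal_pow_of_subsingleton {p : ℕ} [Fact p.Prime] {G : Type*} [CommGroup G] [Subsingleton G]
    (θ : MonoidAlgebra ℤ_[p] G) (ρ : ℕ)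
    (h : θ * MonoidAlgebra.mapDomain (fun σ => σ⁻¹) θ ∈ augIdeal ℤ_[p] G ^ (2 * ρ)) : θ ∈ augIdeal ℤ_[p] G ^ ρ := by
  rcases Nat.eq_zero_or_pos ρ with hρ | hρ
  · rw [hρ, pow_zero, Ideal.one_eq_top]; exact Submodule.mem_top
  · have hI : augIdeal ℤ_[p] G ^ (2 * ρ) ≤ augIdeal ℤ_[p] G := Ideal.pow_le_self (by omega)
    have h0 : augmentation ℤ_[p] G θ = 0 := by
      have h1 : augmentation ℤ_[p] G (θ * MonoidAlgebra.mapDomain (fun σ => σ⁻¹) θ) = 0 := (mem_augIdeal_iff _ _).mp (hI h)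
      rw [map_mul, augmentation_mapDomain_inv, mul_self_eq_zero] at h1
      exact h1
    have hθ : θ = 0 := by rw [eq_single_augmentation_of_subsingleton θ, h0, MonoidAlgebra.single_zero]
    rw [hθ]; exact Ideal.zero_mem _

/-! ### §3 The degenerate branch and the stub for every number field at odd `p` -/

-- see part 8: the stub-shaped statement needs a little more than the default instance budget in this import closure
set_option synthInstance.maxHeartbeats 40000 in
/-- **The degenerate branch `[K:ℚ] = 1`** of the square root along the tower: all `Pic(𝒪_{p^{n+1}})` are trivial (§1), so are the layer groups,
and over a trivial group `θ·ιθ ∈ I^{2ρ} ⇒ θ ∈ I^ρ` (§2). [cite: BertoliniDarmon2005, §1.2 (18)–(21)] -/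
theorem towerSqrt_of_finrank_eq_one :
    ∀ (K : Type) [Field K] [NumberField K] (p : ℕ) [Fact p.Prime] (Nplus Nminus : ℕ)
      (S : Literature.NumberTheory.Automorphic.Brandt.XiSetup Nplus Nminus)
      (T : Literature.NumberTheory.EllipticCurves.GrossPointTower K S p)
      (φ : Literature.NumberTheory.Automorphic.Brandt.ClassSet S.O → ℤ) (α : ℤ_[p]ˣ),
      Module.finrank ℚ K = 1 → T.IsNormCompatible p φ α → ∀ ρ : ℕ,
      (∀ n : ℕ, T.thetaAc p φ α n * MonoidAlgebra.mapDomain (fun σ => σ⁻¹) (T.thetaAc p φ α n) ∈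
        Literature.NumberTheory.EllipticCurves.augIdeal ℤ_[p] (Literature.NumberTheory.EllipticCurves.AcLayerGroup K p (n + 1)) ^
          (2 * ρ)) →
      T.VanishesToOrderAc p φ α ρ := by
  intro K _ _ p _ Nplus Nminus S T φ α h1 _ ρ hyp n
  haveI : ∀ m : ℕ, IsMulCommutative (ClassGroup (quadOrder K (p ^ m))) := fun m => CommMagma.to_isCommutative
  haveI : Subsingleton (ClassGroup (quadOrder K (p ^ (n + 1)))) := subsingleton_classGroup_quadOrder h1 _
  haveI : Subsingleton (AcLayerGroup K p (n + 1)) :=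
    (QuotientGroup.mk'_surjective (torsionImage K p (n + 1))).subsingleton
  exact mem_augIdeal_pow_of_subsingleton _ ρ (hyp n)

set_option synthInstance.maxHeartbeats 40000 in
/-- **The square root along the anticyclotomic tower for EVERY number field `K` and every ODD prime `p`** — the registered stub
`stub_towerSqrt` of crux `DerivedHeightCap` (line «birth») with the single extra hypothesis `p ≠ 2`: a tower of Gross points forces
`[K:ℚ] = 1` (degenerate branch, this file) or `K` imaginary quadratic (part 8, `towerSqrt_of_isImaginaryQuadratic`), by part 9.
What remains of the registered generality is exactly `p = 2`. [cite: BertoliniDarmon2005, §1.2 (18)–(21) and Cor. 3] -/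
theorem towerSqrt_of_ne_two :
    ∀ (K : Type) [Field K] [NumberField K] (p : ℕ) [Fact p.Prime] (Nplus Nminus : ℕ)
      (S : Literature.NumberTheory.Automorphic.Brandt.XiSetup Nplus Nminus)
      (T : Literature.NumberTheory.EllipticCurves.GrossPointTower K S p)
      (φ : Literature.NumberTheory.Automorphic.Brandt.ClassSet S.O → ℤ) (α : ℤ_[p]ˣ),
      p ≠ 2 → T.IsNormCompatible p φ α → ∀ ρ : ℕ,
      (∀ n : ℕ, T.thetaAc p φ α n * MonoidAlgebra.mapDomain (fun σ => σ⁻¹) (T.thetaAc p φ α n) ∈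
        Literature.NumberTheory.EllipticCurves.augIdeal ℤ_[p] (Literature.NumberTheory.EllipticCurves.AcLayerGroup K p (n + 1)) ^
          (2 * ρ)) →
      T.VanishesToOrderAc p φ α ρ := by
  intro K _ _ p _ Nplus Nminus S T φ α hp2 hnc ρ hyp
  rcases finrank_eq_one_or_isImaginaryQuadratic_of_grossPointTower S T with h1 | hK
  · exact towerSqrt_of_finrank_eq_one K p Nplus Nminus S T φ α h1 hnc ρ hyp
  · exact towerSqrt_of_isImaginaryQuadratic K p Nplus Nminus S T φ α hK hp2 hnc ρ hyp

end Summit.BirchSwinnertonDyer.BirchSwinnertonDyer.Theorems.TowerSqrt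

end
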